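import Literature.NumberTheory.Automorphic.ResGL2BorelReduction
import Literature.NumberTheory.Automorphic.BorelEigenvalueFactorisation
import Literature.NumberTheory.Automorphic.UnramifiedLevelChange
import Literature.NumberTheory.Automorphic.TwistedQuotientSubgroupModel
import Literature.NumberTheory.Automorphic.ReducibleGaloisRepOfCharacters
import Literature.NumberTheory.GaloisRepresentations.GrossencharakterAlgebra
import HarnessLib

/-!
# Eigenvalue factorisation on the Borel stratum of `Res_{K/ℚ} GL₂`:
# `a_{w,1} = N(w) ζ_w μ_w⁻¹ + μ_w`, `a_{w,2} = ζ_w`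

Topic `NumberTheory/Automorphic`; namespace `Literature.NumberTheory.Automorphic`, grouping
sub-namespace `ResGLnCohomology`.  A *proofs* file (abbreviations with bodies and theorems; no
named fact, no instance, no `sorry`) under the named fact
`ResGLnCohomology.Harder1987_eigensystem_cuspidalOrEisenstein`, continuing `ResGL2BorelReduction`:
**step (C, factorisation) of the printed proof of its Eisenstein half** [Harder1987, §2], for
`GL₂` over ANY number field `K`, the group `B(K)⁺` (upper triangular, totally positive
determinant) and the coefficients `E_λ` of the receptacle.

The generic factorisation `BigHeckeGLn.exists_eigenvalue_factorisation`
(`BorelEigenvalueFactorisation`: push–pull at the good places in the Borel model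
`H^q(Γ, Fun(H_S ⧸ (U ∩ H_S), V))`, commuting operators, a simultaneous eigenvector) applies to
`Γ = B(K)⁺` mapped diagonally into `H_S` (`diagPos_borelPos_mem_borelAwayFrom`), the level
`U = K_f(𝔫)` (unramified off `S = supp 𝔫`, `H_S · K_f(𝔫) = GL₂(𝔸_K^∞)`) and
`V = E_λ|_{B(K)⁺}`, PROVIDED the cohomology of the stratum is finite-dimensional:

* `ResGLnCohomology.borelPosModelCohomology E K 𝔫 λ q` — the Borel model of the stratum,
  isomorphic to `borelPosCohomology E K 𝔫 λ q` (`TwistedQuotientSubgroupModel`), hence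
  finite-dimensional with it (`finiteDimensional_borelPosModelCohomology`);
* `exists_borelPos_eigenvalue_factorisation` — for `E` algebraically closed of characteristic `0`,
  `𝔫 ≠ 0`, `H^q(B(K)⁺, Fun(GL₂(𝔸_K^∞)/K_f(𝔫), E_λ))` finite-dimensional and a NON-ZERO class `y` in it
  with `T_{w,1} y = a_{w,1} y`, `T_{w,2} y = a_{w,2} y` for almost all `w`: there are `μ_w ≠ 0`, `ζ_w`
  (`w ∤ 𝔫`), realised as the eigenvalues of `T^B_{diag(1,ϖ_w)}` and `T_{ϖ_w · 1}` on a common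
  eigenvector `y₀ ≠ 0` of the Borel model, with **`a_{w,1} = N(w) ζ_w μ_w⁻¹ + μ_w`, `a_{w,2} = ζ_w`**
  for almost all `w` [cite: Harder1987, §2, (2.7)–(2.9)];
* `exists_eigenvalue_factorisation_of_not_mem_interiorLevelCohomology` — the same starting from a
  NON-INTERIOR eigenclass of the receptacle `H^q(S_{K_f(𝔫)}, Ẽ_λ)` (`ResGL2BorelReduction`);
* `eisensteinClause_of_factorisation` — the closing algebra of the Eisenstein half: if moreover
  `w ↦ ι(μ_w)` and `w ↦ ι(ζ_w)` are algebraic Größencharaktere and so is the norm `w ↦ N(w)`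
  (`IsGrossencharakter`), then `ψ₁ = N · ζ · μ⁻¹`, `ψ₂ = μ` are Größencharaktere with
  `ι(a_{w,1}) = ψ₁(w) + ψ₂(w)` and `N(w) ι(a_{w,2}) = ψ₁(w) ψ₂(w)` for almost all `w` — the
  Eisenstein clause of the named fact.

What remains for the Eisenstein half over a totally real `F` (see the unit NOTES): the
finite-dimensionality of `H^q(B(F)⁺, Fun(GL₂(𝔸_F^∞)/K_f(𝔫), E_λ))` (stabilisers are lattices
extended by units), and that `μ`, `ζ` (and `N`) are Größencharaktere [Harder1987, §2.6 Thm. 1].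

## References

* G. Harder, *Eisenstein cohomology of arithmetic groups. The case GL₂*, Invent. Math. 89 (1987),
  §2, (2.7)–(2.9), §2.6 Thm. 1. [Harder1987]
-/

noncomputable section

open scoped Classical
open NumberField IsDedekindDomain CategoryTheory

namespace Literature.NumberTheory.Automorphic

namespace ResGLnCohomology

open ParallelWeight (ProperSubspace lineZero borel)
open BigHeckeGLn Literature.NumberTheory.GaloisRepresentations

variable {E : Type} [Field E] {K : Type} [Field K] [NumberField K]

/-! ### `B(K)⁺` in the good-place group `H_S` and the Borel model of the stratum -/

/-- **`ι(B(K)⁺) ≤ H_S`** for every set of places `S`: the diagonal image of a global upper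
triangular matrix is upper triangular at every place. [cite: Harder1987, §2] -/
theorem diagPos_borelPos_mem_borelAwayFrom (S : Set (HeightOneSpectrum (𝓞 K))) (γ : borelPos K) :
    ((diagPos 2 K).comp (borelPos K).subtype) γ ∈ borelAwayFrom (n := 2) S := by
  have hγ : ((γ : glTotPos 2 K) : GL (Fin 2) K) ∈ standardParabolicGL K (id : Fin 2 → Fin 2) := by
    rw [← ParallelWeight.borel_eq_standardParabolicGL]
    exact (mem_borelPos_iff_coe_mem_borel _).1 γ.2
  exact globalEmbedding_mem_borelAwayFrom hγ S

/-- `H_S · K_f(𝔫) = GL₂(𝔸_K^∞)` for `S = supp 𝔫` (Iwasawa decomposition at the places of `S`,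
integrality elsewhere). [cite: Harder1987, §2] -/
theorem forall_exists_borelAwayFrom_mul_level {𝔫 : Ideal (𝓞 K)} (h𝔫 : 𝔫 ≠ 0) :
    ∀ g : FiniteAdelicGL 2 K,
      ∃ h : borelAwayFrom (n := 2) ({v : HeightOneSpectrum (𝓞 K) | v.asIdeal ∣ 𝔫} : Set _),
        ∃ u ∈ level 2 K 𝔫, g = (h : FiniteAdelicGL 2 K) * u :=
  forall_exists_borelAwayFrom_mul _
    (mem_comap_principalCongruenceLevel_of_localComponent' (n := 2) h𝔫 fun _ hv => hv)

variable (E K) in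
/-- **The Borel model `H^q(B(K)⁺, Fun(H_S ⧸ (K_f(𝔫) ∩ H_S), E_λ))`** of the stratum, `S = supp 𝔫`
(`BigHeckeGLn.borelModelCohomology` for `Γ = B(K)⁺`). [cite: Harder1987, §2] -/
abbrev borelPosModelCohomology (𝔫 : Ideal (𝓞 K)) (lam : (K →+* E) → Fin 2 → ℤ) (q : ℕ) : Type :=
  borelModelCohomology ({v : HeightOneSpectrum (𝓞 K) | v.asIdeal ∣ 𝔫} : Set _) (level 2 K 𝔫)
    ((diagPos 2 K).comp (borelPos K).subtype) (diagPos_borelPos_mem_borelAwayFrom _)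
    ((coeffRepPos E 2 K lam).comp (borelPos K).subtype) q

variable (E K) in
/-- The Hecke operator of `h ∈ H_S` on the Borel model of the stratum. [cite: Harder1987, §2] -/
abbrev borelPosModelHecke (𝔫 : Ideal (𝓞 K)) (lam : (K →+* E) → Fin 2 → ℤ) (q : ℕ)
    (h : borelAwayFrom (n := 2) ({v : HeightOneSpectrum (𝓞 K) | v.asIdeal ∣ 𝔫} : Set _)) :
    Module.End E (borelPosModelCohomology E K 𝔫 lam q) :=
  borelModelHecke ({v : HeightOneSpectrum (𝓞 K) | v.asIdeal ∣ 𝔫} : Set _) (level 2 K 𝔫)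
    ((diagPos 2 K).comp (borelPos K).subtype) (diagPos_borelPos_mem_borelAwayFrom _)
    ((coeffRepPos E 2 K lam).comp (borelPos K).subtype) q h

/-- The restriction `H^q(B(K)⁺, Fun(GL₂(𝔸_K^∞)/K_f(𝔫), E_λ)) ⟶ (Borel model)` is an isomorphism
(`H_S · K_f(𝔫) = GL₂(𝔸_K^∞)`, `TwistedQuotient.isIso_subgroupRestrictMap`). [cite: Harder1987, §2] -/
theorem isIso_subgroupRestrictMap_borelPos {𝔫 : Ideal (𝓞 K)} (h𝔫 : 𝔫 ≠ 0)
    (lam : (K →+* E) → Fin 2 → ℤ) (q : ℕ) :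
    IsIso (TwistedQuotient.subgroupRestrictMap (V := CoeffModule E 2 K lam)
      ((diagPos 2 K).comp (borelPos K).subtype) (level 2 K 𝔫)
      ((coeffRepPos E 2 K lam).comp (borelPos K).subtype)
      (borelAwayFrom (n := 2) ({v : HeightOneSpectrum (𝓞 K) | v.asIdeal ∣ 𝔫} : Set _))
      (diagPos_borelPos_mem_borelAwayFrom _) q) :=
  TwistedQuotient.isIso_subgroupRestrictMap _ _ _ _ _ (forall_exists_borelAwayFrom_mul_level h𝔫) q

/-- **Finite-dimensionality passes to the Borel model.** [cite: Harder1987, §2] -/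
theorem finiteDimensional_borelPosModelCohomology {𝔫 : Ideal (𝓞 K)} (h𝔫 : 𝔫 ≠ 0)
    (lam : (K →+* E) → Fin 2 → ℤ) (q : ℕ)
    [FiniteDimensional E (borelPosCohomology E K 𝔫 lam q)] :
    FiniteDimensional E (borelPosModelCohomology E K 𝔫 lam q) := by
  haveI := isIso_subgroupRestrictMap_borelPos (E := E) h𝔫 lam q
  exact Module.Finite.equiv
    (asIso (TwistedQuotient.subgroupRestrictMap (V := CoeffModule E 2 K lam)
      ((diagPos 2 K).comp (borelPos K).subtype) (level 2 K 𝔫)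
      ((coeffRepPos E 2 K lam).comp (borelPos K).subtype)
      (borelAwayFrom (n := 2) ({v : HeightOneSpectrum (𝓞 K) | v.asIdeal ∣ 𝔫} : Set _))
      (diagPos_borelPos_mem_borelAwayFrom _) q)).toLinearEquiv

/-! ### The factorisation -/

/-- **Hecke eigenvalues on the Borel stratum of `Res_{K/ℚ} GL₂` factor.**  For `E` algebraically
closed of characteristic `0`, `𝔫 ≠ 0`, the stratum cohomology
`H^q(B(K)⁺, Fun(GL₂(𝔸_K^∞)/K_f(𝔫), E_λ))` finite-dimensional, and a NON-ZERO class `y` in it with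
`T_{w,1} y = a_{w,1} y`, `T_{w,2} y = a_{w,2} y` for almost all `w`: there are `μ_w ≠ 0` and `ζ_w`
(`w ∤ 𝔫`), the eigenvalues of `T^B_{diag(1,ϖ_w)}` and of the central `T_{ϖ_w·1}` on a common
eigenvector `y₀ ≠ 0` of the Borel model, with `a_{w,1} = N(w) ζ_w μ_w⁻¹ + μ_w` and `a_{w,2} = ζ_w` for
almost all `w` — the Hecke polynomial `X² − a_{w,1} X + N(w) a_{w,2}` has the roots `μ_w`,
`N(w) ζ_w μ_w⁻¹`. [cite: Harder1987, §2, (2.7)–(2.9)] -/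
theorem exists_borelPos_eigenvalue_factorisation [IsAlgClosed E] [CharZero E] {𝔫 : Ideal (𝓞 K)}
    (h𝔫 : 𝔫 ≠ 0) {lam : (K →+* E) → Fin 2 → ℤ} (q : ℕ)
    [FiniteDimensional E (borelPosCohomology E K 𝔫 lam q)]
    {y : borelPosCohomology E K 𝔫 lam q} (hy : y ≠ 0) (a : HeightOneSpectrum (𝓞 K) → ℕ → E)
    (ha : ∀ᶠ w in Filter.cofinite,
      borelPosHeckeT E K 𝔫 lam q w 1 y = a w 1 • y ∧ borelPosHeckeT E K 𝔫 lam q w 2 y = a w 2 • y) :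
    ∃ (y₀ : borelPosModelCohomology E K 𝔫 lam q) (μ ζ : HeightOneSpectrum (𝓞 K) → E), y₀ ≠ 0 ∧
      (∀ w : HeightOneSpectrum (𝓞 K), ¬ w.asIdeal ∣ 𝔫 →
        borelPosModelHecke E K 𝔫 lam q (borelHeckeElement₂ _ w) y₀ = μ w • y₀ ∧
        borelPosModelHecke E K 𝔫 lam q (borelCentralElement _ w) y₀ = ζ w • y₀ ∧ μ w ≠ 0) ∧
      ∀ᶠ w in Filter.cofinite,
        a w 1 = (Ideal.absNorm w.asIdeal : E) * ζ w * (μ w)⁻¹ + μ w ∧ a w 2 = ζ w := by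
  haveI := finiteDimensional_borelPosModelCohomology (E := E) h𝔫 lam q
  have hSfin : ({v : HeightOneSpectrum (𝓞 K) | v.asIdeal ∣ 𝔫} : Set _).Finite :=
    Ideal.finite_factors h𝔫
  have hUnr : ∀ w, w ∉ ({v : HeightOneSpectrum (𝓞 K) | v.asIdeal ∣ 𝔫} : Set _) →
      ArithmeticQuotient.IsUnramifiedLevel
        (valuedCongruenceSubgroup (Fin 2) (1 : WithZero (Multiplicative ℤ)))
        (ofLocal 2 K w) (localComponent 2 K w) (level 2 K 𝔫) :=
    fun w hw => isUnramifiedLevel_comap_principalCongruenceLevel h𝔫 hw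
  exact exists_eigenvalue_factorisation ((diagPos 2 K).comp (borelPos K).subtype)
    (diagPos_borelPos_mem_borelAwayFrom _) ((coeffRepPos E 2 K lam).comp (borelPos K).subtype) q
    hSfin hUnr (forall_exists_borelAwayFrom_mul_level h𝔫) hy a ha

/-- **From a non-interior eigenclass of the receptacle** (`ResGL2BorelReduction` + the
factorisation): for `c ∈ H^q(S_{K_f(𝔫)}, Ẽ_λ(E)) ∖ H^q_!` an a.e.-eigenclass of `T_{w,1}, T_{w,2}`
with eigenvalues `a_{w,1}, a_{w,2}`, and the stratum cohomology finite-dimensional, the eigenvalues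
factor through `μ_w ≠ 0`, `ζ_w` realised on a common eigenvector `y₀ ≠ 0` of the Borel model.
[cite: Harder1987, §1 and §2, (2.7)–(2.9)] -/
theorem exists_eigenvalue_factorisation_of_not_mem_interiorLevelCohomology [IsAlgClosed E]
    [CharZero E] {𝔫 : Ideal (𝓞 K)} (h𝔫 : 𝔫 ≠ 0) {lam : (K →+* E) → Fin 2 → ℤ} (q : ℕ)
    [FiniteDimensional E (borelPosCohomology E K 𝔫 lam q)]
    {c : levelCohomology E 2 K 𝔫 lam q} (hc : c ∉ interiorLevelCohomology E 2 K 𝔫 lam q)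
    (a : HeightOneSpectrum (𝓞 K) → ℕ → E)
    (ha : ∀ᶠ w in Filter.cofinite,
      heckeT E 2 K 𝔫 lam q w 1 c = a w 1 • c ∧ heckeT E 2 K 𝔫 lam q w 2 c = a w 2 • c) :
    ∃ (y₀ : borelPosModelCohomology E K 𝔫 lam q) (μ ζ : HeightOneSpectrum (𝓞 K) → E), y₀ ≠ 0 ∧
      (∀ w : HeightOneSpectrum (𝓞 K), ¬ w.asIdeal ∣ 𝔫 →
        borelPosModelHecke E K 𝔫 lam q (borelHeckeElement₂ _ w) y₀ = μ w • y₀ ∧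
        borelPosModelHecke E K 𝔫 lam q (borelCentralElement _ w) y₀ = ζ w • y₀ ∧ μ w ≠ 0) ∧
      ∀ᶠ w in Filter.cofinite,
        a w 1 = (Ideal.absNorm w.asIdeal : E) * ζ w * (μ w)⁻¹ + μ w ∧ a w 2 = ζ w := by
  obtain ⟨y, hy0, hy⟩ := exists_borelEigenclass_of_not_mem_interiorLevelCohomology q hc a ha
  exact exists_borelPos_eigenvalue_factorisation h𝔫 q hy0 a hy

/-! ### The closing algebra of the Eisenstein half -/

omit [NumberField K] in
/-- A Größencharakter modulo `𝔣` is one modulo every `𝔣' ≤ 𝔣` (as in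
`BianchiBoundaryEigensystemReducible`, restated to keep the imports of this file small).
[folklore] -/
theorem isGrossencharakter_of_le [NumberField K] {𝔣 𝔣' : Ideal (𝓞 K)} {p q : InfinitePlace K → ℤ}
    {ψ : HeightOneSpectrum (𝓞 K) → ℂ} (h : IsGrossencharakter 𝔣 p q ψ) (hle : 𝔣' ≤ 𝔣) :
    IsGrossencharakter 𝔣' p q ψ :=
  ⟨fun v hv => h.ne_zero v fun hle' => hv (hle.trans hle'),
    fun b c hb hc hcop hbc hpos =>
      h.idealPow_span_eq b c hb hc (hcop.of_isCoprime_of_dvd_right (Ideal.dvd_iff_le.2 hle))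
        (hle hbc) hpos⟩

/-- **The Eisenstein clause from the factorisation.**  If the eigenvalues factor as
`a_{w,1} = N(w) ζ_w μ_w⁻¹ + μ_w`, `a_{w,2} = ζ_w` (almost all `w`) and, through `ι : E ≃+* ℂ`, the
systems `w ↦ ι(μ_w)`, `w ↦ ι(ζ_w)` as well as the norm `w ↦ N(w)` are algebraic Größencharaktere
(`IsGrossencharakter`, any conductors and types), then with the Größencharaktere
`ψ₁ = N · ζ · μ⁻¹` and `ψ₂ = μ` (products and inverses of Größencharaktere,
`GrossencharakterAlgebra`, `ReducibleGaloisRepOfCharacters`) one has `ι(a_{w,1}) = ψ₁(w) + ψ₂(w)`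
and `N(w) ι(a_{w,2}) = ψ₁(w) ψ₂(w)` for almost all `w`: the eigensystem is that of the Eisenstein
class induced from the pair `(ζ μ⁻¹, μ)` of Hecke characters of the torus.
[cite: Harder1987, §2.6 Thm. 1 (p. 56)] -/
theorem eisensteinClause_of_factorisation (ι : E ≃+* ℂ) {a : HeightOneSpectrum (𝓞 K) → ℕ → E}
    {μ ζ : HeightOneSpectrum (𝓞 K) → E}
    (hfac : ∀ᶠ w in Filter.cofinite,
      a w 1 = (Ideal.absNorm w.asIdeal : E) * ζ w * (μ w)⁻¹ + μ w ∧ a w 2 = ζ w)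
    {𝔣μ 𝔣ζ 𝔣N : Ideal (𝓞 K)} (h𝔣μ : 𝔣μ ≠ ⊥) (h𝔣ζ : 𝔣ζ ≠ ⊥) (h𝔣N : 𝔣N ≠ ⊥)
    {pμ qμ pζ qζ pN qN : InfinitePlace K → ℤ}
    (hμ : IsGrossencharakter 𝔣μ pμ qμ fun w => ι (μ w))
    (hζ : IsGrossencharakter 𝔣ζ pζ qζ fun w => ι (ζ w))
    (hN : IsGrossencharakter 𝔣N pN qN fun w => ((Ideal.absNorm w.asIdeal : ℕ) : ℂ)) :
    ∃ (𝔣 : Ideal (𝓞 K)) (p₁ q₁ p₂ q₂ : InfinitePlace K → ℤ) (ψ₁ ψ₂ : HeightOneSpectrum (𝓞 K) → ℂ),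
      𝔣 ≠ ⊥ ∧ IsGrossencharakter 𝔣 p₁ q₁ ψ₁ ∧ IsGrossencharakter 𝔣 p₂ q₂ ψ₂ ∧
      ∀ᶠ w in Filter.cofinite, ι (a w 1) = ψ₁ w + ψ₂ w ∧
        ((Ideal.absNorm w.asIdeal : ℕ) : ℂ) * ι (a w 2) = ψ₁ w * ψ₂ w := by
  -- common conductor
  set 𝔣 : Ideal (𝓞 K) := 𝔣μ * 𝔣ζ * 𝔣N with h𝔣def
  have h𝔣 : 𝔣 ≠ ⊥ := by
    rw [Ne, ← Ideal.zero_eq_bot] at h𝔣μ h𝔣ζ h𝔣N ⊢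
    exact mul_ne_zero (mul_ne_zero h𝔣μ h𝔣ζ) h𝔣N
  have hμ' : IsGrossencharakter 𝔣 pμ qμ fun w => ι (μ w) :=
    isGrossencharakter_of_le hμ ((Ideal.mul_le_right).trans Ideal.mul_le_right)
  have hζ' : IsGrossencharakter 𝔣 pζ qζ fun w => ι (ζ w) :=
    isGrossencharakter_of_le hζ ((Ideal.mul_le_right).trans Ideal.mul_le_left)
  have hN' : IsGrossencharakter 𝔣 pN qN fun w => ((Ideal.absNorm w.asIdeal : ℕ) : ℂ) :=
    isGrossencharakter_of_le hN Ideal.mul_le_left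
  -- `ψ₁ = N ζ μ⁻¹`, `ψ₂ = μ`
  have hψ₁ := (hN'.mul hζ').mul hμ'.inv
  refine ⟨𝔣, _, _, pμ, qμ, _, _, h𝔣, hψ₁, hμ', ?_⟩
  filter_upwards [hfac, (Ideal.finite_factors h𝔣).compl_mem_cofinite] with w hw hw𝔣
  have hwle : ¬ 𝔣 ≤ w.asIdeal := fun hle => hw𝔣 (Ideal.dvd_iff_le.2 hle)
  have hμ0 : ι (μ w) ≠ 0 := hμ'.ne_zero w hwle
  have hμ0' : μ w ≠ 0 := fun h0 => hμ0 (by rw [h0, map_zero])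
  obtain ⟨h1, h2⟩ := hw
  refine ⟨?_, ?_⟩
  · rw [h1, map_add, map_mul, map_mul, map_inv₀, map_natCast]
  · rw [h2]
    field_simp

end ResGLnCohomology

end Literature.NumberTheory.Automorphic

end
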